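import Literature.Analysis.FluidPDE.ElgindiPolarEnergyTwo
import Literature.Analysis.FluidPDE.ElgindiMomentCalculus
import HarnessLib

/-!
# The radial derivative `D_R = R∂_R` commutes with the polar elliptic problem
([Elgindi2021] §7.3, Proposition 7.7, Step 3)

Topic `Literature/Analysis/FluidPDE`. Proof file (everything proved, no definitions, no named
facts) on the proof path of the named fact
`Literature.Analysis.FluidPDE.Elgindi.ElgindiGhoulMasmoudi2021_stabilityCore`
(`ElgindiStabilityDecomposition.lean`). T. M. Elgindi, Ann. of Math. 194 (2021) =
arXiv:1904.04795, §7.3, proof of Proposition 7.7, Step 3 (p. 22 of the held text):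

> "**Step 3: Radial and (weak) angular weights with radial derivatives.** We note that we can rewrite
> (7.1) in the following convenient form:
> `L(Ψ) = −α²(R∂_R)²Ψ − 5αR∂_RΨ − ∂_θθΨ + ∂_θ(tan(θ)Ψ) − 6Ψ = F`. Recall the notation `D_R = R∂_R`.
> Consequently, `L(D_R^kΨ) = D_R^kF` for `k = 0, 1, 2`. Thus, using Steps 1 and 2 […]"

(and likewise [ElgindiGhoulMasmoudi2021] §6: "Observe that `D_R` commutes with (6.1), so this allows us
to prove higher elliptic regularity estimates for the radial derivatives"). This file proves the
calculus behind this remark for the curried slice-derivative vocabulary of the tree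
(`Dz f z θ = z·∂_z f`, `ellipticOp`):

* `dz_Dz`, `dz_dz_Dz`, `dθ_Dz`, `dθ_dθ_Dz`: the slice derivatives of `D_RΨ`;
* `ellipticOp_Dz`: **`L(D_RΨ) = D_R(L(Ψ))` on the open strip** for `Ψ ∈ C³(ℝ²)`;
* `Dz_cosProfile`: `D_R(cos θ·χ) = cos θ·D_Rχ` (the a-priori class of Step 1 is stable under `D_R`);
* `ellipticOp_Dz_orthogonal`: if `L(Ψ) ⊥ sin θcos²θ` on every slice `R > 0` then so is `L(D_RΨ)`
  (differentiation of the `K`-moment under the integral sign, `ElgindiMomentCalculus.lean`).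
-/

noncomputable section

open MeasureTheory Set Real Filter Function
open _root_.Topology

namespace Literature.Analysis.FluidPDE

namespace Elgindi

/-! ### Slice derivatives of `D_RΨ` -/

/-- `∂_R(D_RΨ) = ∂_RΨ + R∂_RRΨ` for `Ψ ∈ C²(ℝ²)`. [folklore] -/
theorem dz_Dz {Ψ : ℝ → ℝ → ℝ} (hΨ : ContDiff ℝ 2 (uncurry Ψ)) (R θ : ℝ) :
    dz (Dz Ψ) R θ = dz Ψ R θ + R * dz (dz Ψ) R θ := by
  have hdzΨ : ContDiff ℝ 1 (uncurry (dz Ψ)) := contDiff_dz_of_contDiff (n := 1) hΨ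
  have hd : DifferentiableAt ℝ (fun R' => dz Ψ R' θ) R :=
    ((hdzΨ.comp (contDiff_id.prodMk contDiff_const)).differentiable (by simp)) R
  show deriv (fun R' => R' * dz Ψ R' θ) R = _
  have h : HasDerivAt (fun R' => R' * dz Ψ R' θ) (1 * dz Ψ R θ + R * deriv (fun R' => dz Ψ R' θ) R) R :=
    (hasDerivAt_id' R).mul hd.hasDerivAt
  rw [h.deriv]
  show 1 * dz Ψ R θ + R * dz (dz Ψ) R θ = _
  ring

/-- `∂_RR(D_RΨ) = 2∂_RRΨ + R∂_RRRΨ` for `Ψ ∈ C³(ℝ²)`. [folklore] -/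
theorem dz_dz_Dz {Ψ : ℝ → ℝ → ℝ} (hΨ : ContDiff ℝ 3 (uncurry Ψ)) (R θ : ℝ) :
    dz (dz (Dz Ψ)) R θ = 2 * dz (dz Ψ) R θ + R * dz (dz (dz Ψ)) R θ := by
  have hΨ2 : ContDiff ℝ 2 (uncurry Ψ) := hΨ.of_le (by norm_num)
  have hdzΨ : ContDiff ℝ 2 (uncurry (dz Ψ)) := contDiff_dz_of_contDiff (n := 2) hΨ
  have hdz2Ψ : ContDiff ℝ 1 (uncurry (dz (dz Ψ))) := contDiff_dz_of_contDiff (n := 1) hdzΨ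
  have e : dz (Dz Ψ) = fun R θ => dz Ψ R θ + R * dz (dz Ψ) R θ := funext fun R => funext fun θ => dz_Dz hΨ2 R θ
  rw [e]
  show deriv (fun R' => dz Ψ R' θ + R' * dz (dz Ψ) R' θ) R = _
  have hdzΨ1 : ContDiff ℝ 1 (uncurry (dz Ψ)) := hdzΨ.of_le (by norm_num)
  have hd1 : DifferentiableAt ℝ (fun R' => dz Ψ R' θ) R :=
    ((hdzΨ1.comp (contDiff_id.prodMk contDiff_const)).differentiable (by simp)) R
  have hd2 : DifferentiableAt ℝ (fun R' => dz (dz Ψ) R' θ) R :=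
    ((hdz2Ψ.comp (contDiff_id.prodMk contDiff_const)).differentiable (by simp)) R
  have h : HasDerivAt (fun R' => dz Ψ R' θ + R' * dz (dz Ψ) R' θ)
      (deriv (fun R' => dz Ψ R' θ) R + (1 * dz (dz Ψ) R θ + R * deriv (fun R' => dz (dz Ψ) R' θ) R)) R :=
    hd1.hasDerivAt.add ((hasDerivAt_id' R).mul hd2.hasDerivAt)
  rw [h.deriv]
  show dz (dz Ψ) R θ + (1 * dz (dz Ψ) R θ + R * dz (dz (dz Ψ)) R θ) = _
  ring

/-- `∂_θ(D_RΨ) = R∂_θ∂_RΨ` (pointwise, no regularity needed). [folklore] -/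
theorem dθ_Dz (Ψ : ℝ → ℝ → ℝ) (R θ : ℝ) : dθ (Dz Ψ) R θ = R * dθ (dz Ψ) R θ := by
  show deriv (fun θ' => R * dz Ψ R θ') θ = R * deriv (fun θ' => dz Ψ R θ') θ
  exact deriv_const_mul_field R

/-- `∂_θθ(D_RΨ) = R∂_θθ∂_RΨ` (pointwise). [folklore] -/
theorem dθ_dθ_Dz (Ψ : ℝ → ℝ → ℝ) (R θ : ℝ) : dθ (dθ (Dz Ψ)) R θ = R * dθ (dθ (dz Ψ)) R θ := by
  have e : dθ (Dz Ψ) = fun R θ => R * dθ (dz Ψ) R θ := funext fun R => funext fun θ => dθ_Dz Ψ R θ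
  rw [e]
  show deriv (fun θ' => R * dθ (dz Ψ) R θ') θ = R * deriv (fun θ' => dθ (dz Ψ) R θ') θ
  exact deriv_const_mul_field R

/-- `D_R(R²∂_RRΨ) = R²∂_RR(D_RΨ)`: the radial second-order term commutes with `D_R` (`Ψ ∈ C³`). [folklore] -/
theorem Dz_sq_mul_dz_dz {Ψ : ℝ → ℝ → ℝ} (hΨ : ContDiff ℝ 3 (uncurry Ψ)) (R θ : ℝ) :
    Dz (fun R θ => R ^ 2 * dz (dz Ψ) R θ) R θ = R ^ 2 * dz (dz (Dz Ψ)) R θ := by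
  have hdzΨ : ContDiff ℝ 2 (uncurry (dz Ψ)) := contDiff_dz_of_contDiff (n := 2) hΨ
  have hdz2Ψ : ContDiff ℝ 1 (uncurry (dz (dz Ψ))) := contDiff_dz_of_contDiff (n := 1) hdzΨ
  have hd2 : DifferentiableAt ℝ (fun R' => dz (dz Ψ) R' θ) R :=
    ((hdz2Ψ.comp (contDiff_id.prodMk contDiff_const)).differentiable (by simp)) R
  rw [dz_dz_Dz hΨ]
  show R * deriv (fun R' => R' ^ 2 * dz (dz Ψ) R' θ) R = _
  have h : HasDerivAt (fun R' => R' ^ 2 * dz (dz Ψ) R' θ)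
      (((2 : ℕ) : ℝ) * R ^ (2 - 1) * 1 * dz (dz Ψ) R θ + R ^ 2 * deriv (fun R' => dz (dz Ψ) R' θ) R) R :=
    ((hasDerivAt_id' R).pow 2).mul hd2.hasDerivAt
  rw [h.deriv]
  show R * ((2 : ℕ) * R ^ (2 - 1) * 1 * dz (dz Ψ) R θ + R ^ 2 * dz (dz (dz Ψ)) R θ) = _
  norm_num
  ring

/-! ### The commutation of the operator with `D_R` -/

/-- **`L(D_RΨ) = D_R(L(Ψ))` on the open strip** for `Ψ ∈ C³(ℝ²)` ("we can rewrite (7.1) as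
`−α²(R∂_R)²Ψ − 5αR∂_RΨ − ∂_θθΨ + ∂_θ(tan θΨ) − 6Ψ`; consequently `L(D_R^kΨ) = D_R^kF`").
[cite: Elgindi2021, §7.3 proof of Proposition 7.7, Step 3 (p. 22 of arXiv:1904.04795)] -/
theorem ellipticOp_Dz (α : ℝ) {Ψ : ℝ → ℝ → ℝ} (hΨ : ContDiff ℝ 3 (uncurry Ψ)) {p : ℝ × ℝ} (hp : p ∈ strip) :
    ellipticOp α (Dz Ψ) p.1 p.2 = Dz (ellipticOp α Ψ) p.1 p.2 := by
  have hΨ2 : ContDiff ℝ 2 (uncurry Ψ) := hΨ.of_le (by norm_num)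
  have hΨ1 : ContDiff ℝ 1 (uncurry Ψ) := hΨ.of_le (by norm_num)
  have hdzΨ : ContDiff ℝ 2 (uncurry (dz Ψ)) := contDiff_dz_of_contDiff (n := 2) hΨ
  have hdz2Ψ : ContDiff ℝ 1 (uncurry (dz (dz Ψ))) := contDiff_dz_of_contDiff (n := 1) hdzΨ
  have hdθΨ : ContDiff ℝ 2 (uncurry (dθ Ψ)) := contDiff_dθ_of_contDiff (n := 2) hΨ
  have hdθ2Ψ : ContDiff ℝ 1 (uncurry (dθ (dθ Ψ))) := contDiff_dθ_of_contDiff (n := 1) hdθΨ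
  have hDz : ContDiff ℝ 2 (uncurry (Dz Ψ)) := contDiff_Dz_of_contDiff (n := 2) hΨ
  set R := p.1 with hR
  set θ := p.2 with hθ
  have hRpos : 0 < R := hp.1
  have hcos : Real.cos θ ≠ 0 := (Real.cos_pos_of_mem_Ioo ⟨by linarith [hp.2.1, Real.pi_pos], hp.2.2⟩).ne'
  -- mixed partials on the strip
  have hcomm1 : dθ (dz Ψ) R θ = dz (dθ Ψ) R θ := dθ_dz_eq_dz_dθ hΨ2.contDiffOn hp
  have hcommA : dz (dθ (dθ Ψ)) R θ = dθ (dθ (dz Ψ)) R θ := by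
    rw [← dθ_dz_eq_dz_dθ hdθΨ.contDiffOn hp]
    exact dθ_congr (fun q hq => (dθ_dz_eq_dz_dθ hΨ2.contDiffOn hq).symm) hp
  -- the left-hand side, expanded
  have hdD : DifferentiableAt ℝ (fun θ' => Dz Ψ R θ') θ :=
    ((hDz.comp (contDiff_const.prodMk contDiff_id)).differentiable (by simp)) θ
  have hL := ellipticOp_eq_expanded α hdD hcos
  rw [dz_dz_Dz hΨ, dz_Dz hΨ2, dθ_dθ_Dz, dθ_Dz] at hL
  -- the right-hand side: differentiate the expanded slice `R' ↦ L(Ψ)(R', θ)`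
  have hud : ∀ R', DifferentiableAt ℝ (fun θ' => Ψ R' θ') θ := fun R' =>
    ((hΨ1.comp (contDiff_const.prodMk contDiff_id)).differentiable (by simp)) θ
  have hE : (fun R' => ellipticOp α Ψ R' θ) = fun R' => -α ^ 2 * R' ^ 2 * dz (dz Ψ) R' θ - α * (5 + α) * R' * dz Ψ R' θ -
      dθ (dθ Ψ) R' θ + (Ψ R' θ / Real.cos θ ^ 2 + Real.sin θ * dθ Ψ R' θ / Real.cos θ) - 6 * Ψ R' θ :=
    funext fun R' => ellipticOp_eq_expanded α (hud R') hcos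
  have d0 : HasDerivAt (fun R' => Ψ R' θ) (dz Ψ R θ) R :=
    (((hΨ1.comp (contDiff_id.prodMk contDiff_const)).differentiable (by simp)) R).hasDerivAt
  have d1 : HasDerivAt (fun R' => dz Ψ R' θ) (dz (dz Ψ) R θ) R :=
    ((((hdzΨ.of_le (by norm_num) : ContDiff ℝ 1 (uncurry (dz Ψ))).comp
      (contDiff_id.prodMk contDiff_const)).differentiable (by simp)) R).hasDerivAt
  have d2 : HasDerivAt (fun R' => dz (dz Ψ) R' θ) (dz (dz (dz Ψ)) R θ) R :=
    (((hdz2Ψ.comp (contDiff_id.prodMk contDiff_const)).differentiable (by simp)) R).hasDerivAt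
  have d3 : HasDerivAt (fun R' => dθ (dθ Ψ) R' θ) (dz (dθ (dθ Ψ)) R θ) R :=
    (((hdθ2Ψ.comp (contDiff_id.prodMk contDiff_const)).differentiable (by simp)) R).hasDerivAt
  have d4 : HasDerivAt (fun R' => dθ Ψ R' θ) (dz (dθ Ψ) R θ) R :=
    ((((hdθΨ.of_le (by norm_num) : ContDiff ℝ 1 (uncurry (dθ Ψ))).comp
      (contDiff_id.prodMk contDiff_const)).differentiable (by simp)) R).hasDerivAt
  have dsq : HasDerivAt (fun R' : ℝ => R' ^ 2) (2 * R) R := (hasDerivAt_pow 2 R).congr_deriv (by norm_num)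
  have hall : HasDerivAt (fun R' => -α ^ 2 * R' ^ 2 * dz (dz Ψ) R' θ - α * (5 + α) * R' * dz Ψ R' θ -
      dθ (dθ Ψ) R' θ + (Ψ R' θ / Real.cos θ ^ 2 + Real.sin θ * dθ Ψ R' θ / Real.cos θ) - 6 * Ψ R' θ)
      (-α ^ 2 * (2 * R * dz (dz Ψ) R θ + R ^ 2 * dz (dz (dz Ψ)) R θ) - α * (5 + α) * (1 * dz Ψ R θ + R * dz (dz Ψ) R θ) -
        dz (dθ (dθ Ψ)) R θ + (dz Ψ R θ / Real.cos θ ^ 2 + Real.sin θ * dz (dθ Ψ) R θ / Real.cos θ) - 6 * dz Ψ R θ) R := by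
    have t1 : HasDerivAt (fun R' => -α ^ 2 * R' ^ 2 * dz (dz Ψ) R' θ) (-α ^ 2 * (2 * R * dz (dz Ψ) R θ + R ^ 2 * dz (dz (dz Ψ)) R θ)) R := by
      have := (dsq.fun_mul d2).const_mul (-α ^ 2)
      refine (this.congr_of_eventuallyEq (Filter.Eventually.of_forall fun R' => by ring)).congr_deriv (by ring)
    have t2 : HasDerivAt (fun R' => α * (5 + α) * R' * dz Ψ R' θ) (α * (5 + α) * (1 * dz Ψ R θ + R * dz (dz Ψ) R θ)) R := by
      have := ((hasDerivAt_id' R).fun_mul d1).const_mul (α * (5 + α))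
      refine (this.congr_of_eventuallyEq (Filter.Eventually.of_forall fun R' => by ring)).congr_deriv (by ring)
    have t4 : HasDerivAt (fun R' => Ψ R' θ / Real.cos θ ^ 2 + Real.sin θ * dθ Ψ R' θ / Real.cos θ)
        (dz Ψ R θ / Real.cos θ ^ 2 + Real.sin θ * dz (dθ Ψ) R θ / Real.cos θ) R :=
      (d0.div_const _).add ((d4.const_mul (Real.sin θ)).div_const _)
    have t5 : HasDerivAt (fun R' => 6 * Ψ R' θ) (6 * dz Ψ R θ) R := d0.const_mul 6
    exact (((t1.sub t2).sub d3).add t4).sub t5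
  have hRHS : Dz (ellipticOp α Ψ) R θ = R * (-α ^ 2 * (2 * R * dz (dz Ψ) R θ + R ^ 2 * dz (dz (dz Ψ)) R θ) -
      α * (5 + α) * (1 * dz Ψ R θ + R * dz (dz Ψ) R θ) - dz (dθ (dθ Ψ)) R θ +
      (dz Ψ R θ / Real.cos θ ^ 2 + Real.sin θ * dz (dθ Ψ) R θ / Real.cos θ) - 6 * dz Ψ R θ) := by
    show R * deriv (fun R' => ellipticOp α Ψ R' θ) R = _
    rw [hE, hall.deriv]
  rw [hL, hRHS, Dz_eq_mul_dz, hcommA, hcomm1]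
  ring

/-! ### The a-priori class is stable under `D_R` -/

/-- `D_R(cos θ·χ) = cos θ·D_Rχ` for `χ ∈ C¹(ℝ²)`. [folklore] -/
theorem Dz_cosProfile {χ : ℝ → ℝ → ℝ} (hχ : ContDiff ℝ 1 (uncurry χ)) :
    Dz (fun R θ => Real.cos θ * χ R θ) = fun R θ => Real.cos θ * Dz χ R θ := by
  funext R θ
  rw [Dz_eq_mul_dz, Dz_eq_mul_dz, dz_cosProfile hχ]
  ring

/-- `(D_Rχ)(R, 0) = 0` when `χ(R, 0) = 0` for all `R`. [folklore] -/
theorem Dz_eq_zero_of_forall {χ : ℝ → ℝ → ℝ} (h0 : ∀ R, χ R 0 = 0) (R : ℝ) : Dz χ R 0 = 0 := by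
  rw [Dz_eq_mul_dz, dz_eq_zero_of_forall h0]; ring

/-- The support of `D_Rχ` stays inside `R > 0` when that of `χ` does. [folklore] -/
theorem tsupport_Dz_pos {χ : ℝ → ℝ → ℝ} (hpos : ∀ p ∈ tsupport (uncurry χ), 0 < p.1) :
    ∀ p ∈ tsupport (uncurry (Dz χ)), 0 < p.1 := fun p hp => hpos p (tsupport_Dz_subset hp)

/-! ### Orthogonality of `L(D_RΨ)` from that of `L(Ψ)` -/

/-- **If `L(Ψ) ⊥ sin θcos²θ` on every slice `R > 0`, then so is `L(D_RΨ)`** (for the a-priori class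
`Ψ = cos θ·χ`, `χ ∈ C⁴(ℝ²)` compactly supported): `(L(D_RΨ), K)_θ = R∂_R(L(Ψ), K)_θ = 0`
by the commutation `L(D_RΨ) = D_R L(Ψ)` and differentiation of the `K`-moment under the integral
sign. [cite: Elgindi2021, §7.3 proof of Proposition 7.7, Step 3 (p. 22 of arXiv:1904.04795)] -/
theorem ellipticOp_Dz_orthogonal {α : ℝ} {χ : ℝ → ℝ → ℝ} (hχ : ContDiff ℝ 4 (uncurry χ))
    (hs : HasCompactSupport (uncurry χ)) {Ψ : ℝ → ℝ → ℝ}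
    (hΨ : Ψ = fun R θ => Real.cos θ * χ R θ)
    (horth : ∀ R, 0 < R → ∫ θ in Ioo 0 (π / 2), ellipticOp α Ψ R θ * kernelK θ = 0) :
    ∀ R, 0 < R → ∫ θ in Ioo 0 (π / 2), ellipticOp α (Dz Ψ) R θ * kernelK θ = 0 := by
  have hχ3 : ContDiff ℝ 3 (uncurry χ) := hχ.of_le (by norm_num)
  have hχ1 : ContDiff ℝ 1 (uncurry χ) := hχ.of_le (by norm_num)
  have hΨ4 : ContDiff ℝ 4 (uncurry Ψ) := by rw [hΨ]; exact contDiff_cosProfile hχ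
  have hΨ3 : ContDiff ℝ 3 (uncurry Ψ) := hΨ4.of_le (by norm_num)
  have hΨ2 : ContDiff ℝ 2 (uncurry Ψ) := hΨ4.of_le (by norm_num)
  have hΨ1 : ContDiff ℝ 1 (uncurry Ψ) := hΨ4.of_le (by norm_num)
  have hΨs : HasCompactSupport (uncurry Ψ) := by rw [hΨ]; exact hasCompactSupport_cosProfile hs
  have hdzΨ : ContDiff ℝ 3 (uncurry (dz Ψ)) := contDiff_dz_of_contDiff (n := 3) hΨ4
  have hdz2Ψ : ContDiff ℝ 2 (uncurry (dz (dz Ψ))) := contDiff_dz_of_contDiff (n := 2) hdzΨ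
  have hdθΨ : ContDiff ℝ 3 (uncurry (dθ Ψ)) := contDiff_dθ_of_contDiff (n := 3) hΨ4
  have hdθ2Ψ : ContDiff ℝ 2 (uncurry (dθ (dθ Ψ))) := contDiff_dθ_of_contDiff (n := 2) hdθΨ
  have hdθχ : ContDiff ℝ 3 (uncurry (dθ χ)) := contDiff_dθ_of_contDiff (n := 3) hχ
  have hdzΨs : HasCompactSupport (uncurry (dz Ψ)) := hasCompactSupport_dz hΨs
  have hdz2Ψs : HasCompactSupport (uncurry (dz (dz Ψ))) := hasCompactSupport_dz hdzΨs
  have hdθΨs : HasCompactSupport (uncurry (dθ Ψ)) := hasCompactSupport_dθ_of hΨs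
  have hdθ2Ψs : HasCompactSupport (uncurry (dθ (dθ Ψ))) := hasCompactSupport_dθ_of hdθΨs
  have hdθχs : HasCompactSupport (uncurry (dθ χ)) := hasCompactSupport_dθ_of hs
  -- the smooth representative of `L(Ψ)` (equal to it on the strip)
  obtain ⟨gF, hgF⟩ : ∃ gF : ℝ → ℝ → ℝ, gF = fun R θ => -α ^ 2 * R ^ 2 * dz (dz Ψ) R θ - α * (5 + α) * R * dz Ψ R θ -
      dθ (dθ Ψ) R θ + (Real.cos θ * χ R θ + Real.sin θ * dθ χ R θ) - 6 * Ψ R θ := ⟨_, rfl⟩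
  have hgF1 : ContDiff ℝ 1 (uncurry gF) := by
    have e : uncurry gF = fun p : ℝ × ℝ => -α ^ 2 * p.1 ^ 2 * uncurry (dz (dz Ψ)) p - α * (5 + α) * p.1 * uncurry (dz Ψ) p -
        uncurry (dθ (dθ Ψ)) p + (Real.cos p.2 * uncurry χ p + Real.sin p.2 * uncurry (dθ χ) p) - 6 * uncurry Ψ p := by
      funext p; rw [hgF]; rfl
    rw [e]
    have h1 := hdz2Ψ.of_le (show (1 : WithTop ℕ∞) ≤ 2 by norm_num)
    have h2 := hdzΨ.of_le (show (1 : WithTop ℕ∞) ≤ 3 by norm_num)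
    have h3 := hdθ2Ψ.of_le (show (1 : WithTop ℕ∞) ≤ 2 by norm_num)
    have h4 := hdθχ.of_le (show (1 : WithTop ℕ∞) ≤ 3 by norm_num)
    fun_prop
  have hgFs : HasCompactSupport (uncurry gF) := by
    refine HasCompactSupport.of_support_subset_isCompact
      ((((hdz2Ψs.isCompact.union hdzΨs.isCompact).union hdθ2Ψs.isCompact).union (hs.isCompact.union hdθχs.isCompact)).union hΨs.isCompact)
      fun p hp => ?_
    by_contra h
    simp only [mem_union, not_or] at h
    obtain ⟨⟨⟨⟨h1, h2⟩, h3⟩, ⟨h4, h5⟩⟩, h6⟩ := h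
    have z1 : dz (dz Ψ) p.1 p.2 = 0 := by have := image_eq_zero_of_notMem_tsupport h1; exact this
    have z2 : dz Ψ p.1 p.2 = 0 := by have := image_eq_zero_of_notMem_tsupport h2; exact this
    have z3 : dθ (dθ Ψ) p.1 p.2 = 0 := by have := image_eq_zero_of_notMem_tsupport h3; exact this
    have z4 : χ p.1 p.2 = 0 := by have := image_eq_zero_of_notMem_tsupport h4; exact this
    have z5 : dθ χ p.1 p.2 = 0 := by have := image_eq_zero_of_notMem_tsupport h5; exact this
    have z6 : Ψ p.1 p.2 = 0 := by have := image_eq_zero_of_notMem_tsupport h6; exact this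
    apply hp
    show gF p.1 p.2 = 0
    rw [hgF]; simp [z1, z2, z3, z4, z5, z6]
  have hFG : ∀ R θ, 0 < R → θ ∈ Ioo 0 (π / 2) → ellipticOp α Ψ R θ = gF R θ := by
    intro R θ hR hθ
    have hcos : Real.cos θ ≠ 0 := (Real.cos_pos_of_mem_Ioo ⟨by linarith [hθ.1, Real.pi_pos], hθ.2⟩).ne'
    have hΨp : Ψ R θ = Real.cos θ * χ R θ := by rw [hΨ]
    have hT : Ψ R θ / Real.cos θ ^ 2 + Real.sin θ * (-Real.sin θ * χ R θ + Real.cos θ * dθ χ R θ) / Real.cos θ =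
        Real.cos θ * χ R θ + Real.sin θ * dθ χ R θ := by
      rw [hΨp, div_add_div _ _ (pow_ne_zero 2 hcos) hcos, div_eq_iff (mul_ne_zero (pow_ne_zero 2 hcos) hcos)]
      have := Real.sin_sq_add_cos_sq θ
      linear_combination (-(Real.cos θ ^ 2 * χ R θ)) * this
    have hdθp : dθ Ψ R θ = -Real.sin θ * χ R θ + Real.cos θ * dθ χ R θ := by rw [hΨ, dθ_cosProfile hχ1]
    have hud : DifferentiableAt ℝ (fun θ' => Ψ R θ') θ :=
      ((hΨ2.comp (contDiff_const.prodMk contDiff_id)).differentiable (by simp)) θ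
    have hGp : gF R θ = -α ^ 2 * R ^ 2 * dz (dz Ψ) R θ - α * (5 + α) * R * dz Ψ R θ -
        dθ (dθ Ψ) R θ + (Real.cos θ * χ R θ + Real.sin θ * dθ χ R θ) - 6 * Ψ R θ := by rw [hgF]
    rw [hGp, ellipticOp_eq_expanded α hud hcos, hdθp, hT]
  -- `(K, gF(R,·)) ≡ 0` on `R > 0`, hence its derivative vanishes there
  have hK0 : ∀ R, 0 < R → kMoment gF R = 0 := by
    intro R hR
    calc kMoment gF R = ∫ θ in Ioo 0 (π / 2), ellipticOp α Ψ R θ * kernelK θ := by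
          rw [kMoment_def]
          exact setIntegral_congr_fun measurableSet_Ioo fun θ hθ => by rw [hFG R θ hR hθ]
      _ = 0 := horth R hR
  intro R hR
  have hderiv0 : deriv (kMoment gF) R = 0 := by
    have hev : kMoment gF =ᶠ[𝓝 R] fun _ => 0 :=
      Filter.eventuallyEq_of_mem (Ioi_mem_nhds hR) fun R' hR' => hK0 R' hR'
    rw [hev.deriv_eq, deriv_const]
  -- `L(D_RΨ)(R,θ) = R ∂_R gF(R,θ)` on the slice
  have hpt : ∀ θ ∈ Ioo 0 (π / 2), ellipticOp α (Dz Ψ) R θ * kernelK θ = R * (dz gF R θ * kernelK θ) := by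
    intro θ hθ
    have hp : (R, θ) ∈ strip := ⟨hR, hθ⟩
    have h1 := ellipticOp_Dz α hΨ3 hp
    simp only at h1
    have h2 : deriv (fun R' => ellipticOp α Ψ R' θ) R = deriv (fun R' => gF R' θ) R := by
      refine Filter.EventuallyEq.deriv_eq (Filter.eventuallyEq_of_mem (Ioi_mem_nhds hR) fun R' hR' => ?_)
      exact hFG R' θ hR' hθ
    rw [h1]
    show R * deriv (fun R' => ellipticOp α Ψ R' θ) R * kernelK θ = R * (dz gF R θ * kernelK θ)
    rw [h2]
    show R * dz gF R θ * kernelK θ = R * (dz gF R θ * kernelK θ)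
    ring
  rw [setIntegral_congr_fun measurableSet_Ioo hpt, MeasureTheory.integral_const_mul]
  have h3 : ∫ θ in Ioo 0 (π / 2), dz gF R θ * kernelK θ = kMoment (dz gF) R := (kMoment_def _ _).symm
  rw [h3, ← deriv_kMoment hgF1 hgFs R, hderiv0, mul_zero]

end Elgindi

end Literature.Analysis.FluidPDE
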